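import Literature.MathematicalPhysics.QuantumFieldTheory.ConformalBootstrap3D.PointKernelK57Data

/-!
# K57 certificate, kernel block file M0: (M) rows `0 ≤ j < 25` of `mrowsK57`, in 6 row groups

`decide` by kernel reduction of the (M) block checker `PCert.mBlockOK` of `PointKernel` on the literal
data of `PointKernelK57Data`; soundness is `PCert.mBlockOK_sound`.  Estimated kernel time 184 s.
-/

set_option maxRecDepth 100000
set_option maxHeartbeats 0

namespace Literature.MathematicalPhysics.QuantumFieldTheory.ConformalBootstrap3D.PointKernelK57

open Literature.MathematicalPhysics.QuantumFieldTheory.ConformalBootstrap3D.PointKernel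

/-- (M) rows `[0, 5)` pass the kernel evaluator. [folklore] -/
theorem mBlock_0 : certK57.mBlockOK mrowsK57 0 5 = true := by
  decide +kernel

/-- (M) rows `[5, 10)` pass the kernel evaluator. [folklore] -/
theorem mBlock_5 : certK57.mBlockOK mrowsK57 5 10 = true := by
  decide +kernel

/-- (M) rows `[10, 15)` pass the kernel evaluator. [folklore] -/
theorem mBlock_10 : certK57.mBlockOK mrowsK57 10 15 = true := by
  decide +kernel

/-- (M) rows `[15, 19)` pass the kernel evaluator. [folklore] -/
theorem mBlock_15 : certK57.mBlockOK mrowsK57 15 19 = true := by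
  decide +kernel

/-- (M) rows `[19, 23)` pass the kernel evaluator. [folklore] -/
theorem mBlock_19 : certK57.mBlockOK mrowsK57 19 23 = true := by
  decide +kernel

/-- (M) rows `[23, 25)` pass the kernel evaluator. [folklore] -/
theorem mBlock_23 : certK57.mBlockOK mrowsK57 23 25 = true := by
  decide +kernel

end Literature.MathematicalPhysics.QuantumFieldTheory.ConformalBootstrap3D.PointKernelK57
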